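import Mathlib

/-!
# Smyth's theorem, isolation of `θ₀` — Lemmas 12.18, 12.19 and (12.49) (venture `DiscreteObjects`, target L)

Cell `pub-namedobj`, seat `pub-namedobj-mahler` (gen 9). Framing: lottery ticket; floor = certified
bounds/negative ranges.

Fifth piece of the isolation part of [McKee–Smyth, *Around the Unit Circle*, Thm 12.1] (case `ℓ ≥ 2k`,
§12.2.5–12.2.6), as PURE REAL ARITHMETIC on two real sequences `F, G : ℕ → ℝ` (the Taylor coefficients of
the Smyth pair `f, g`; `F 0 = G 0 = c = 1/M(P)`), the sign `a = a_k = ±1`, and the constants `C = θ₀⁻¹`,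
`Ci = θ₀` (`C·Ci = 1`, `C² + C³ = 1`, `0.7548 < C < 0.7549`), `δ = C - c ∈ [0, 10⁻³)`.  The analytic input is
reduced to two hypotheses, the `H²`-contraction ("Parseval", (12.38) and (12.47)) inequalities for the
series `F₁ = f·(1 + aC z^k)` and `G₁ = g·(Ci - a(1+C) z^k + z^{2k})`, whose coefficients are

  `fco n = F n + aC·F(n-k)·[k ≤ n]`,  `gco n = Ci·G n - a(1+C)·G(n-k)·[k ≤ n] + G(n-2k)·[2k ≤ n]`.

* `smyth_12_18` — (12.33)–(12.35): `fco 0 = c`, `|fco k - a| ≤ 7δ`, `|fco i| ≤ 4√δ` (`i ≠ 0, k`);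
* `smyth_12_19` — (12.41)–(12.43): `|gco k + a(1+C)| ≤ 14δ`, `|gco 2k - Ci| ≤ 54δ`, `|gco i| ≤ 15√δ`;
* `smyth_gamma_eq`, `smyth_w_eq` — (12.31)/(12.32): for `n ≥ 2k+1` the coefficients
  `γ_n = F n - a F(n-k) + a F(n-3k)` of `f·Q₀(a z^k)` and `w_n = G n - G(n-2k) + a G(n-3k)` of `g·P₀(a z^k)`
  are `fco n - a(1+C) fco(n-k) + Ci fco(n-2k)` and `C gco n + a gco(n-k)`;
* `smyth_12_49` — **(12.49)**: `|γ_n - w_n| ≤ 44√δ` for all `n ≥ 2k+1`.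
-/

namespace Summit.Ventures.DiscreteObjects.Mahler

open Finset

/-! ### Small tools -/

/-- Three distinct terms of a sum of squares. -/
theorem sq3_le_sum_sq {u : ℕ → ℝ} {i j l N : ℕ} (hij : i ≠ j) (hil : i ≠ l) (hjl : j ≠ l)
    (hi : i < N) (hj : j < N) (hl : l < N) :
    u i ^ 2 + u j ^ 2 + u l ^ 2 ≤ ∑ n ∈ range N, u n ^ 2 := by
  have hsub : ({i, j, l} : Finset ℕ) ⊆ range N := by
    intro n hn
    simp only [mem_insert, mem_singleton] at hn
    rw [mem_range]; omega
  have h := sum_le_sum_of_subset_of_nonneg (f := fun n => u n ^ 2) hsub (fun n _ _ => sq_nonneg (u n))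
  rw [sum_insert (by simp [hij, hil]), sum_insert (by simp [hjl]), sum_singleton] at h
  linarith

/-- Four distinct terms of a sum of squares. -/
theorem sq4_le_sum_sq {u : ℕ → ℝ} {i j l m N : ℕ} (hij : i ≠ j) (hil : i ≠ l) (him : i ≠ m)
    (hjl : j ≠ l) (hjm : j ≠ m) (hlm : l ≠ m) (hi : i < N) (hj : j < N) (hl : l < N) (hm : m < N) :
    u i ^ 2 + u j ^ 2 + u l ^ 2 + u m ^ 2 ≤ ∑ n ∈ range N, u n ^ 2 := by
  have hsub : ({i, j, l, m} : Finset ℕ) ⊆ range N := by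
    intro n hn
    simp only [mem_insert, mem_singleton] at hn
    rw [mem_range]; omega
  have h := sum_le_sum_of_subset_of_nonneg (f := fun n => u n ^ 2) hsub (fun n _ _ => sq_nonneg (u n))
  rw [sum_insert (by simp [hij, hil, him]), sum_insert (by simp [hjl, hjm]), sum_insert (by simp [hlm]),
    sum_singleton] at h
  linarith

/-- `x² ≤ K² δ` with `K ≥ 0` gives `|x| ≤ K √δ`. -/
theorem abs_le_mul_sqrt_of_sq_le {x δ K : ℝ} (hK : 0 ≤ K) (h : x ^ 2 ≤ K ^ 2 * δ) :
    |x| ≤ K * Real.sqrt δ := by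
  have := Real.abs_le_sqrt h
  rwa [Real.sqrt_mul (sq_nonneg K), Real.sqrt_sq hK] at this

/-- `|K u| ≤ K B` from `|u| ≤ B`, `K ≥ 0`. -/
theorem abs_mul_le_mul {K u B : ℝ} (hK : 0 ≤ K) (h : |u| ≤ B) : |K * u| ≤ K * B := by
  rw [abs_mul, abs_of_nonneg hK]; exact mul_le_mul_of_nonneg_left h hK

/-- The constants: `Ci = C + C²`, `1.3245 < Ci < 1.3248`, `0.5697 < C² < 0.5699`. -/
theorem smyth_constants {C Ci : ℝ} (hC1 : 7548 / 10000 < C) (hC2 : C < 7549 / 10000)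
    (hCeq : C ^ 2 + C ^ 3 = 1) (hCCi : C * Ci = 1) :
    Ci = C + C ^ 2 ∧ 13245 / 10000 < Ci ∧ Ci < 13248 / 10000 := by
  have hCi2 : Ci = C + C ^ 2 := by linear_combination (C + C ^ 2) * hCCi - Ci * hCeq
  refine ⟨hCi2, ?_, ?_⟩ <;> rw [hCi2] <;> nlinarith

/-- `√δ` bookkeeping: for `0 ≤ δ < 10⁻³`, `s = √δ` has `s ≥ 0`, `s² = δ`, `δ ≤ s/31`. -/
theorem sqrt_facts {δ : ℝ} (hδ0 : 0 ≤ δ) (hδ3 : δ < 1 / 1000) :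
    0 ≤ Real.sqrt δ ∧ Real.sqrt δ ^ 2 = δ ∧ δ ≤ Real.sqrt δ / 31 := by
  have hs0 := Real.sqrt_nonneg δ
  have hs2 : Real.sqrt δ ^ 2 = δ := Real.sq_sqrt hδ0
  refine ⟨hs0, hs2, ?_⟩
  have hs : Real.sqrt δ ≤ 1 / 31 := by nlinarith
  nlinarith

/-! ### Lemma 12.18 -/

/-- **Lemma 12.18, (12.33)–(12.35).** -/
theorem smyth_12_18 {F fco : ℕ → ℝ} {c C a : ℝ} {k : ℕ} (hk : 1 ≤ k) (ha : a = 1 ∨ a = -1)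
    (hc : 3 / 4 ≤ c) (hcC : c ≤ C) (hδ3 : C - c < 1 / 1000) (hC2 : C < 7549 / 10000)
    (hF0 : F 0 = c) (hFk : |F k - a * (1 - c ^ 2)| ≤ 6 * (C - c))
    (hfco : ∀ n, fco n = F n + if k ≤ n then a * C * F (n - k) else 0)
    (hHf : ∀ N, ∑ n ∈ range N, fco n ^ 2 ≤ 1 + C ^ 2) :
    fco 0 = c ∧ |fco k - a| ≤ 7 * (C - c) ∧ ∀ i, i ≠ 0 → i ≠ k → |fco i| ≤ 4 * Real.sqrt (C - c) := by
  have haa : a * a = 1 := by rcases ha with h | h <;> subst h <;> norm_num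
  have habs : |a| = 1 := by rcases ha with h | h <;> subst h <;> norm_num
  obtain ⟨δ, rfl⟩ : ∃ δ, c = C - δ := ⟨C - c, by ring⟩
  simp only [sub_sub_cancel] at hδ3 hFk ⊢
  have hδ0 : 0 ≤ δ := by linarith
  have hf0 : fco 0 = C - δ := by rw [hfco, if_neg (by omega), add_zero, hF0]
  have hfk : fco k = F k + a * C * (C - δ) := by rw [hfco, if_pos le_rfl, Nat.sub_self, hF0]
  have hfka : |fco k - a| ≤ 7 * δ := by
    have e : fco k - a = (F k - a * (1 - (C - δ) ^ 2)) + a * ((C - δ) * δ) := by rw [hfk]; ring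
    rw [e]
    have hcd : 0 ≤ (C - δ) * δ := mul_nonneg (by linarith) hδ0
    calc |F k - a * (1 - (C - δ) ^ 2) + a * ((C - δ) * δ)|
        ≤ |F k - a * (1 - (C - δ) ^ 2)| + |a * ((C - δ) * δ)| := abs_add_le _ _
      _ ≤ 6 * δ + (C - δ) * δ := by rw [abs_mul, habs, one_mul, abs_of_nonneg hcd]; linarith
      _ ≤ 7 * δ := by nlinarith
  refine ⟨hf0, hfka, fun i hi0 hik => ?_⟩
  have hsum := sq3_le_sum_sq (u := fco) (i := 0) (j := k) (l := i) (N := k + i + 1)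
    (by omega) (by omega) (fun h => hik h.symm) (by omega) (by omega) (by omega)
  have hH := hHf (k + i + 1)
  have h1 : fco i ^ 2 ≤ 1 + C ^ 2 - (C - δ) ^ 2 - fco k ^ 2 := by rw [hf0] at hsum; linarith
  -- `1 - fco k² ≤ 14δ + 49δ²` via `t := a·fco k ≥ 1 - 7δ`
  have ht : 1 - 7 * δ ≤ a * fco k := by
    have : |a * fco k - 1| ≤ 7 * δ := by
      have e : a * fco k - 1 = a * (fco k - a) := by linear_combination haa
      rw [e, abs_mul, habs, one_mul]; exact hfka
    linarith [(abs_le.mp this).1]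
  have ht2 : (a * fco k) ^ 2 = fco k ^ 2 := by rw [mul_pow, show a ^ 2 = 1 by rw [sq]; exact haa, one_mul]
  have h2 : 1 - fco k ^ 2 ≤ 14 * δ + 49 * δ ^ 2 := by
    have := mul_self_le_mul_self (by linarith : 0 ≤ 1 - 7 * δ) ht
    nlinarith [ht2]
  have h3 : C ^ 2 - (C - δ) ^ 2 ≤ 151 / 100 * δ := by nlinarith
  have h4 : fco i ^ 2 ≤ 4 ^ 2 * δ := by nlinarith
  exact abs_le_mul_sqrt_of_sq_le (by norm_num) h4

/-! ### Lemma 12.19 -/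

/-- (12.41), arithmetic: `g_k = Ci·G_k - a(1+C)c` with `G_k = -a(c²+c-1) + e`, `|e| ≤ 6δ`. -/
theorem smyth_12_41 {C Ci a δ e gk : ℝ} (ha : a = 1 ∨ a = -1) (hδ0 : 0 ≤ δ) (hδ3 : δ < 1 / 1000)
    (hC1 : 7548 / 10000 < C) (hC2 : C < 7549 / 10000) (hCeq : C ^ 2 + C ^ 3 = 1) (hCCi : C * Ci = 1)
    (he : |e| ≤ 6 * δ)
    (hgk : gk = Ci * (-a * ((C - δ) ^ 2 + (C - δ) - 1) + e) - a * (1 + C) * (C - δ)) :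
    |gk + a * (1 + C)| ≤ 14 * δ := by
  have habs : |a| = 1 := by rcases ha with h | h <;> subst h <;> norm_num
  obtain ⟨hCi2, hCi1, hCi3⟩ := smyth_constants hC1 hC2 hCeq hCCi
  have hCi0 : 0 ≤ Ci := by linarith
  have hu_eq : gk + a * (1 + C) = a * (δ * (Ci * (2 * C - δ + 1) + 1 + C)) + Ci * e := by
    rw [hgk, hCi2]; linear_combination (-(a * (C + 1))) * hCeq
  rw [hu_eq]
  have hin : 0 ≤ δ * (Ci * (2 * C - δ + 1) + 1 + C) := mul_nonneg hδ0 (by nlinarith)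
  have hCiδ : Ci * δ ≤ 13248 / 10000 * δ := mul_le_mul_of_nonneg_right hCi3.le hδ0
  have hCδ : C * δ ≤ 7549 / 10000 * δ := mul_le_mul_of_nonneg_right hC2.le hδ0
  have hCiCδ : Ci * C * δ ≤ 13248 / 10000 * (7549 / 10000) * δ := by
    have : Ci * C ≤ 13248 / 10000 * (7549 / 10000) := by nlinarith
    exact mul_le_mul_of_nonneg_right this hδ0
  have hδδ : 0 ≤ Ci * δ * δ := by positivity
  calc |a * (δ * (Ci * (2 * C - δ + 1) + 1 + C)) + Ci * e|
      ≤ |a * (δ * (Ci * (2 * C - δ + 1) + 1 + C))| + |Ci * e| := abs_add_le _ _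
    _ ≤ δ * (Ci * (2 * C - δ + 1) + 1 + C) + Ci * (6 * δ) := by
        rw [abs_mul, habs, one_mul, abs_of_nonneg hin]
        exact add_le_add_right (abs_mul_le_mul hCi0 he) _
    _ ≤ 14 * δ := by linarith

/-- (12.42), arithmetic: `g_{2k} = Ci·G_{2k} - a(1+C)G_k + c`. -/
theorem smyth_12_42 {C Ci a δ e G2k g2k : ℝ} (ha : a = 1 ∨ a = -1) (hδ0 : 0 ≤ δ) (hδ3 : δ < 1 / 1000)
    (hC1 : 7548 / 10000 < C) (hC2 : C < 7549 / 10000) (hCeq : C ^ 2 + C ^ 3 = 1) (hCCi : C * Ci = 1)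
    (he : |e| ≤ 6 * δ) (hG2k : |G2k| ≤ 28 * δ)
    (hg2k : g2k = Ci * G2k - a * (1 + C) * (-a * ((C - δ) ^ 2 + (C - δ) - 1) + e) + (C - δ)) :
    |g2k - Ci| ≤ 54 * δ := by
  have haa : a * a = 1 := by rcases ha with h | h <;> subst h <;> norm_num
  have habs : |a| = 1 := by rcases ha with h | h <;> subst h <;> norm_num
  obtain ⟨hCi2, hCi1, hCi3⟩ := smyth_constants hC1 hC2 hCeq hCCi
  have hCi0 : 0 ≤ Ci := by linarith
  have hv_eq : g2k - Ci = Ci * G2k - a * (1 + C) * e - δ * ((1 + C) * (2 * C - δ + 1) + 1) := by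
    rw [hg2k, hCi2]; linear_combination ((1 + C) * ((C - δ) ^ 2 + (C - δ) - 1)) * haa + hCeq
  rw [hv_eq]
  have hin : 0 ≤ δ * ((1 + C) * (2 * C - δ + 1) + 1) := mul_nonneg hδ0 (by nlinarith)
  have h1 : |Ci * G2k| ≤ Ci * (28 * δ) := abs_mul_le_mul hCi0 hG2k
  have h2 : |a * (1 + C) * e| ≤ (1 + C) * (6 * δ) := by
    rw [mul_assoc, abs_mul, habs, one_mul]; exact abs_mul_le_mul (by linarith) he
  have hCiδ : Ci * δ ≤ 13248 / 10000 * δ := mul_le_mul_of_nonneg_right hCi3.le hδ0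
  have hCδ : C * δ ≤ 7549 / 10000 * δ := mul_le_mul_of_nonneg_right hC2.le hδ0
  have hCCδ : C * C * δ ≤ 7549 / 10000 * (7549 / 10000) * δ := by
    have : C * C ≤ 7549 / 10000 * (7549 / 10000) := by nlinarith
    exact mul_le_mul_of_nonneg_right this hδ0
  have hδδ : 0 ≤ (1 + C) * δ * δ := by positivity
  calc |Ci * G2k - a * (1 + C) * e - δ * ((1 + C) * (2 * C - δ + 1) + 1)|
      ≤ |Ci * G2k| + |a * (1 + C) * e| + |δ * ((1 + C) * (2 * C - δ + 1) + 1)| := by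
        linarith [abs_sub (Ci * G2k - a * (1 + C) * e) (δ * ((1 + C) * (2 * C - δ + 1) + 1)),
          abs_sub (Ci * G2k) (a * (1 + C) * e)]
    _ ≤ Ci * (28 * δ) + (1 + C) * (6 * δ) + δ * ((1 + C) * (2 * C - δ + 1) + 1) := by
        rw [abs_of_nonneg hin]; linarith
    _ ≤ 54 * δ := by linarith

/-- (12.43), arithmetic: one generic coefficient from the Parseval budget. -/
theorem smyth_12_43 {C Ci a δ g0 gk g2k gi : ℝ} (ha : a = 1 ∨ a = -1) (hδ0 : 0 ≤ δ) (hδ3 : δ < 1 / 1000)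
    (hC1 : 7548 / 10000 < C) (hC2 : C < 7549 / 10000) (hCeq : C ^ 2 + C ^ 3 = 1) (hCCi : C * Ci = 1)
    (hg0 : g0 = 1 - Ci * δ) (hu : |gk + a * (1 + C)| ≤ 14 * δ) (hv : |g2k - Ci| ≤ 54 * δ)
    (hsum : g0 ^ 2 + gk ^ 2 + g2k ^ 2 + gi ^ 2 ≤ Ci ^ 2 + (1 + C) ^ 2 + 1) :
    gi ^ 2 ≤ 15 ^ 2 * δ := by
  have haa : a * a = 1 := by rcases ha with h | h <;> subst h <;> norm_num
  have habs : |a| = 1 := by rcases ha with h | h <;> subst h <;> norm_num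
  obtain ⟨-, hCi1, hCi3⟩ := smyth_constants hC1 hC2 hCeq hCCi
  -- `1 - g0² ≤ 2 Ci δ`
  have h2 : 1 - g0 ^ 2 ≤ 2 * Ci * δ := by rw [hg0]; nlinarith [sq_nonneg (Ci * δ)]
  -- `(1+C)² - gk² ≤ 28(1+C)δ` via `t := -a·gk ≥ (1+C) - 14δ`
  have h3 : (1 + C) ^ 2 - gk ^ 2 ≤ 28 * (1 + C) * δ := by
    have ht : (1 + C) - 14 * δ ≤ -a * gk := by
      have : |-a * gk - (1 + C)| ≤ 14 * δ := by
        have e1 : -a * gk - (1 + C) = -a * (gk + a * (1 + C)) := by linear_combination (1 + C) * haa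
        rw [e1, abs_mul, abs_neg, habs, one_mul]; exact hu
      linarith [(abs_le.mp this).1]
    have ht2 : (-a * gk) ^ 2 = gk ^ 2 := by
      rw [mul_pow, neg_pow_two, show a ^ 2 = 1 by rw [sq]; exact haa, one_mul]
    have := mul_self_le_mul_self (by nlinarith : 0 ≤ (1 + C) - 14 * δ) ht
    nlinarith [ht2]
  -- `Ci² - g2k² ≤ 108 Ci δ`
  have h4 : Ci ^ 2 - g2k ^ 2 ≤ 108 * Ci * δ := by
    have ht : Ci - 54 * δ ≤ g2k := by linarith [(abs_le.mp hv).1]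
    have := mul_self_le_mul_self (by nlinarith : 0 ≤ Ci - 54 * δ) ht
    nlinarith
  have hCiδ : Ci * δ ≤ 13248 / 10000 * δ := mul_le_mul_of_nonneg_right hCi3.le hδ0
  have hCδ : C * δ ≤ 7549 / 10000 * δ := mul_le_mul_of_nonneg_right hC2.le hδ0
  linarith

/-- **Lemma 12.19, (12.41)–(12.43).** -/
theorem smyth_12_19 {G gco : ℕ → ℝ} {c C Ci a : ℝ} {k : ℕ} (hk : 1 ≤ k) (ha : a = 1 ∨ a = -1)
    (hcC : c ≤ C) (hδ3 : C - c < 1 / 1000) (hC1 : 7548 / 10000 < C)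
    (hC2 : C < 7549 / 10000) (hCeq : C ^ 2 + C ^ 3 = 1) (hCCi : C * Ci = 1)
    (hG0 : G 0 = c) (hGk : |G k + a * (c ^ 2 + c - 1)| ≤ 6 * (C - c)) (hG2k : |G (2 * k)| ≤ 28 * (C - c))
    (hgco : ∀ n, gco n = Ci * G n - (if k ≤ n then a * (1 + C) * G (n - k) else 0) +
      (if 2 * k ≤ n then G (n - 2 * k) else 0))
    (hHg : ∀ N, ∑ n ∈ range N, gco n ^ 2 ≤ Ci ^ 2 + (1 + C) ^ 2 + 1) :
    |gco k + a * (1 + C)| ≤ 14 * (C - c) ∧ |gco (2 * k) - Ci| ≤ 54 * (C - c) ∧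
      ∀ i, i ≠ 0 → i ≠ k → i ≠ 2 * k → |gco i| ≤ 15 * Real.sqrt (C - c) := by
  obtain ⟨δ, rfl⟩ : ∃ δ, c = C - δ := ⟨C - c, by ring⟩
  simp only [sub_sub_cancel] at hδ3 hGk hG2k ⊢
  have hδ0 : 0 ≤ δ := by linarith
  have hg0 : gco 0 = 1 - Ci * δ := by
    rw [hgco, if_neg (by omega), if_neg (by omega), hG0]; linear_combination hCCi
  have hgk : gco k = Ci * G k - a * (1 + C) * (C - δ) := by
    rw [hgco, if_pos le_rfl, if_neg (by omega), Nat.sub_self, hG0]; ring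
  have hg2k : gco (2 * k) = Ci * G (2 * k) - a * (1 + C) * G k + (C - δ) := by
    rw [hgco, if_pos (by omega), if_pos le_rfl, show 2 * k - k = k by omega, Nat.sub_self, hG0]
  -- `e := G k + a(c²+c-1)`, `|e| ≤ 6δ`
  obtain ⟨e, he⟩ : ∃ e, e = G k + a * ((C - δ) ^ 2 + (C - δ) - 1) := ⟨_, rfl⟩
  rw [← he] at hGk
  have hGke : G k = -a * ((C - δ) ^ 2 + (C - δ) - 1) + e := by rw [he]; ring
  rw [hGke] at hgk hg2k
  have hu := smyth_12_41 ha hδ0 hδ3 hC1 hC2 hCeq hCCi hGk hgk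
  have hv := smyth_12_42 ha hδ0 hδ3 hC1 hC2 hCeq hCCi hGk hG2k hg2k
  refine ⟨hu, hv, fun i hi0 hik hi2k => ?_⟩
  have hsum := sq4_le_sum_sq (u := gco) (i := 0) (j := k) (l := 2 * k) (m := i) (N := 2 * k + i + 1)
    (by omega) (by omega) (fun h => hi0 h.symm) (by omega) (fun h => hik h.symm) (fun h => hi2k h.symm)
    (by omega) (by omega) (by omega) (by omega)
  have h5 := smyth_12_43 ha hδ0 hδ3 hC1 hC2 hCeq hCCi hg0 hu hv (le_trans hsum (hHg _))
  exact abs_le_mul_sqrt_of_sq_le (by norm_num) h5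

/-! ### The coefficients `γ_n`, `w_n` and (12.49) -/

/-- (12.31): for `n ≥ 2k+1`, `γ_n := F n - a F(n-k) + a F(n-3k)·[3k ≤ n]` equals
`fco n - a(1+C) fco(n-k) + Ci fco(n-2k)` (uses `C² + C³ = 1`, `Ci = C + C²`, `a² = 1`). -/
theorem smyth_gamma_eq {F fco : ℕ → ℝ} {C Ci a : ℝ} {k n : ℕ} (haa : a * a = 1)
    (hCeq : C ^ 2 + C ^ 3 = 1) (hCi2 : Ci = C + C ^ 2)
    (hfco : ∀ n, fco n = F n + if k ≤ n then a * C * F (n - k) else 0) (hn : 2 * k + 1 ≤ n) :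
    F n - a * F (n - k) + (if 3 * k ≤ n then a * F (n - 3 * k) else 0) =
      fco n - a * (1 + C) * fco (n - k) + Ci * fco (n - 2 * k) := by
  have hkn : k ≤ n := by omega
  have hkn' : k ≤ n - k := by omega
  rw [hfco n, hfco (n - k), hfco (n - 2 * k), if_pos hkn, if_pos hkn',
    show n - k - k = n - 2 * k by omega, show n - 2 * k - k = n - 3 * k by omega, hCi2]
  by_cases h3 : 3 * k ≤ n
  · have h3' : k ≤ n - 2 * k := by omega
    rw [if_pos h3, if_pos h3']
    linear_combination ((C + C ^ 2) * F (n - 2 * k)) * haa + (-(a * F (n - 3 * k))) * hCeq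
  · have h3' : ¬ k ≤ n - 2 * k := by omega
    rw [if_neg h3, if_neg h3']
    linear_combination ((C + C ^ 2) * F (n - 2 * k)) * haa

/-- (12.32): for `n ≥ 2k+1`, `w_n := G n - G(n-2k) + a G(n-3k)·[3k ≤ n]` equals `C gco n + a gco(n-k)`
(uses `C·Ci = 1`, `Ci = C + C²`, `a² = 1`). -/
theorem smyth_w_eq {G gco : ℕ → ℝ} {C Ci a : ℝ} {k n : ℕ} (haa : a * a = 1) (hCCi : C * Ci = 1)
    (hCi2 : Ci = C + C ^ 2)
    (hgco : ∀ n, gco n = Ci * G n - (if k ≤ n then a * (1 + C) * G (n - k) else 0) +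
      (if 2 * k ≤ n then G (n - 2 * k) else 0)) (hn : 2 * k + 1 ≤ n) :
    G n - G (n - 2 * k) + (if 3 * k ≤ n then a * G (n - 3 * k) else 0) =
      C * gco n + a * gco (n - k) := by
  have hkn : k ≤ n := by omega
  have h2kn : 2 * k ≤ n := by omega
  have hkn' : k ≤ n - k := by omega
  rw [hgco n, hgco (n - k), if_pos hkn, if_pos h2kn, if_pos hkn',
    show n - k - k = n - 2 * k by omega, show n - k - 2 * k = n - 3 * k by omega]
  by_cases h3 : 3 * k ≤ n
  · have h3' : 2 * k ≤ n - k := by omega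
    rw [if_pos h3, if_pos h3']
    linear_combination (-(G n)) * hCCi + (-(a * G (n - k))) * hCi2 + ((1 + C) * G (n - 2 * k)) * haa
  · have h3' : ¬ 2 * k ≤ n - k := by omega
    rw [if_neg h3, if_neg h3']
    linear_combination (-(G n)) * hCCi + (-(a * G (n - k))) * hCi2 + ((1 + C) * G (n - 2 * k)) * haa

/-- **(12.49).**  For every `n ≥ 2k+1`, `|γ_n - w_n| ≤ 44 √(C - c)`. -/
theorem smyth_12_49 {F G fco gco : ℕ → ℝ} {c C Ci a : ℝ} {k : ℕ} (hk : 1 ≤ k) (ha : a = 1 ∨ a = -1)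
    (hc : 3 / 4 ≤ c) (hcC : c ≤ C) (hδ3 : C - c < 1 / 1000) (hC1 : 7548 / 10000 < C)
    (hC2 : C < 7549 / 10000) (hCeq : C ^ 2 + C ^ 3 = 1) (hCCi : C * Ci = 1)
    (hF0 : F 0 = c) (hG0 : G 0 = c) (hFk : |F k - a * (1 - c ^ 2)| ≤ 6 * (C - c))
    (hGk : |G k + a * (c ^ 2 + c - 1)| ≤ 6 * (C - c)) (hG2k : |G (2 * k)| ≤ 28 * (C - c))
    (hfco : ∀ n, fco n = F n + if k ≤ n then a * C * F (n - k) else 0)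
    (hgco : ∀ n, gco n = Ci * G n - (if k ≤ n then a * (1 + C) * G (n - k) else 0) +
      (if 2 * k ≤ n then G (n - 2 * k) else 0))
    (hHf : ∀ N, ∑ n ∈ range N, fco n ^ 2 ≤ 1 + C ^ 2)
    (hHg : ∀ N, ∑ n ∈ range N, gco n ^ 2 ≤ Ci ^ 2 + (1 + C) ^ 2 + 1)
    {n : ℕ} (hn : 2 * k + 1 ≤ n) :
    |(F n - a * F (n - k) + (if 3 * k ≤ n then a * F (n - 3 * k) else 0)) -
      (G n - G (n - 2 * k) + (if 3 * k ≤ n then a * G (n - 3 * k) else 0))| ≤ 44 * Real.sqrt (C - c) := by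
  have haa : a * a = 1 := by rcases ha with h | h <;> subst h <;> norm_num
  have habs : |a| = 1 := by rcases ha with h | h <;> subst h <;> norm_num
  obtain ⟨hCi2, hCi1, hCi3⟩ := smyth_constants hC1 hC2 hCeq hCCi
  rw [smyth_gamma_eq haa hCeq hCi2 hfco hn, smyth_w_eq haa hCCi hCi2 hgco hn]
  obtain ⟨-, hfk, hfi⟩ := smyth_12_18 hk ha hc hcC hδ3 hC2 hF0 hFk hfco hHf
  obtain ⟨-, hg2k, hgi⟩ := smyth_12_19 hk ha hcC hδ3 hC1 hC2 hCeq hCCi hG0 hGk hG2k hgco hHg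
  obtain ⟨hs0, -, hδs⟩ := sqrt_facts (sub_nonneg.mpr hcC) hδ3
  have hδ0 : 0 ≤ C - c := sub_nonneg.mpr hcC
  have h1C : 0 ≤ 1 + C := by linarith
  have hCi0 : 0 ≤ Ci := by linarith
  have hC0 : 0 ≤ C := by linarith
  have hCs : C * Real.sqrt (C - c) ≤ 7549 / 10000 * Real.sqrt (C - c) :=
    mul_le_mul_of_nonneg_right hC2.le hs0
  have hCis : Ci * Real.sqrt (C - c) ≤ 13248 / 10000 * Real.sqrt (C - c) :=
    mul_le_mul_of_nonneg_right hCi3.le hs0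
  have hCiδ : Ci * (C - c) ≤ 13248 / 10000 * (C - c) := mul_le_mul_of_nonneg_right hCi3.le hδ0
  -- generic bounds
  have bfn : |fco n| ≤ 4 * Real.sqrt (C - c) := hfi n (by omega) (by omega)
  have bfnk : |fco (n - k)| ≤ 4 * Real.sqrt (C - c) := hfi (n - k) (by omega) (by omega)
  have bgn : |gco n| ≤ 15 * Real.sqrt (C - c) := hgi n (by omega) (by omega) (by omega)
  have t2 : |-(a * (1 + C) * fco (n - k))| ≤ (1 + C) * (4 * Real.sqrt (C - c)) := by
    rw [abs_neg, mul_assoc, abs_mul, habs, one_mul]; exact abs_mul_le_mul h1C bfnk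
  have t4 : |-(C * gco n)| ≤ C * (15 * Real.sqrt (C - c)) := by rw [abs_neg]; exact abs_mul_le_mul hC0 bgn
  by_cases h3k : n = 3 * k
  · -- `n = 3k`: `fco(n-2k) = fco k ≈ a`, `gco(n-k) = gco 2k ≈ Ci`
    have e2 : n - 2 * k = k := by omega
    have e1 : n - k = 2 * k := by omega
    rw [e2, e1]
    rw [e1] at bfnk t2
    have hsplit : fco n - a * (1 + C) * fco (2 * k) + Ci * fco k - (C * gco n + a * gco (2 * k)) =
        fco n + (-(a * (1 + C) * fco (2 * k))) + Ci * (fco k - a) + (-(C * gco n)) +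
          (-(a * (gco (2 * k) - Ci))) := by ring
    rw [hsplit]
    have t3 : |Ci * (fco k - a)| ≤ Ci * (7 * (C - c)) := abs_mul_le_mul hCi0 hfk
    have t5 : |-(a * (gco (2 * k) - Ci))| ≤ 54 * (C - c) := by
      rw [abs_neg, abs_mul, habs, one_mul]; exact hg2k
    linarith [abs_add_le (fco n + (-(a * (1 + C) * fco (2 * k))) + Ci * (fco k - a) + (-(C * gco n)))
        (-(a * (gco (2 * k) - Ci))),
      abs_add_le (fco n + (-(a * (1 + C) * fco (2 * k))) + Ci * (fco k - a)) (-(C * gco n)),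
      abs_add_le (fco n + (-(a * (1 + C) * fco (2 * k)))) (Ci * (fco k - a)),
      abs_add_le (fco n) (-(a * (1 + C) * fco (2 * k)))]
  · -- `n ≠ 3k`: all five coefficients are generic
    have bfn2k : |fco (n - 2 * k)| ≤ 4 * Real.sqrt (C - c) := hfi (n - 2 * k) (by omega) (by omega)
    have bgnk : |gco (n - k)| ≤ 15 * Real.sqrt (C - c) := hgi (n - k) (by omega) (by omega) (by omega)
    have hsplit : fco n - a * (1 + C) * fco (n - k) + Ci * fco (n - 2 * k) - (C * gco n + a * gco (n - k)) =
        fco n + (-(a * (1 + C) * fco (n - k))) + Ci * fco (n - 2 * k) + (-(C * gco n)) +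
          (-(a * gco (n - k))) := by ring
    rw [hsplit]
    have t3 : |Ci * fco (n - 2 * k)| ≤ Ci * (4 * Real.sqrt (C - c)) := abs_mul_le_mul hCi0 bfn2k
    have t5 : |-(a * gco (n - k))| ≤ 15 * Real.sqrt (C - c) := by
      rw [abs_neg, abs_mul, habs, one_mul]; exact bgnk
    linarith [abs_add_le (fco n + (-(a * (1 + C) * fco (n - k))) + Ci * fco (n - 2 * k) + (-(C * gco n)))
        (-(a * gco (n - k))),
      abs_add_le (fco n + (-(a * (1 + C) * fco (n - k))) + Ci * fco (n - 2 * k)) (-(C * gco n)),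
      abs_add_le (fco n + (-(a * (1 + C) * fco (n - k)))) (Ci * fco (n - 2 * k)),
      abs_add_le (fco n) (-(a * (1 + C) * fco (n - k)))]

end Summit.Ventures.DiscreteObjects.Mahler
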